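import Summits.BirchSwinnertonDyer.Rank1Residual.GaloisImage.WildFiveThreeAdicTower
import HarnessLib

/-!
# The wild `3`-adic tower OFF `v₃(j − 1728) = 3`: the two regimes together, the `j`-form, and the
# kernel bound "EXOTIC ⟹ v₃(j − 1728) = 3"
# (cell `b2b-bsdres`, team n1011, seat p02 gen 3, OWNERS row T-b10 'wild tower at 3' ARM A, file F4;
# generic corollaries of `GaloisImage/WildThreeAdicTower.lean` (`m ∈ {1,2,4}`) and
# `GaloisImage/WildFiveThreeAdicTower.lean` (`m ≥ 5`) — the class-side `Additive/` assembly is ARM B's,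
# seat p14, lead ruling R5-33)

HONEST FRAMING (cell `b2b-bsdres`, run/shared/lean/b2b/bsd-rank1-residual/, verbatim in every
file): the goal of the cell is to DELETE the COMBINATION-SHAPED residual classes of the
Birch–Swinnerton-Dyer formula for ALL analytic-rank `≤ 1` elliptic curves over `ℚ` — "full BSD
formula for every rank `≤ 1` curve in class `C`" assembled STRICTLY from published theorems — so
that the rank-`≤ 1` remainder becomes exactly the CONSTRUCTION-SHAPED classes, which are TYPED
(missing-input `Prop`s), NOT attempted. This is not "finishing BSD". Team n1011 (N10 / N11, the
additive block X4 ∧ `p = 3`): research route on the CONSTRUCTION-SHAPED class X4; no claim beyond the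
stated classes; nothing is booked. Theorems only (no definition, no named fact).

* `padicValRat_three_1728` — `v₃(1728) = 3`.
* `towerSurj_three_of_surj_of_padicValRat_j` — `ρ̄_{E,3}` onto and `v₃(j(E)) ∈ {1, 2}` ⟹ `ρ̄_{E,3ⁿ}`
  onto for every `n` (for `v₃(j) < 3` one has `v₃(j − 1728) = v₃(j)`).
* `not_padicValRat_j_sub_of_not_towerSurj_three` — `ρ̄_{E,3}` onto and the tower FAILS ⟹
  `v₃(j − 1728) ∉ {1, 2, 4}` (any model, any reduction type).
* **`towerSurj_three_of_surj_of_padicValRat_j_sub_ne_three`** — `ρ̄_{E,3}` onto and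
  `1 ≤ v₃(j − 1728) = m ≠ 3` ⟹ the tower (both regimes); and the kernel bound on N11's EXOTIC residue
  contributed by ARM A: **`padicValRat_j_sub_eq_three_or_nonpos_of_not_towerSurj_three`** — `ρ̄_{E,3}`
  onto and the tower failing force `v₃(j − 1728) = 3` or `v₃(j − 1728) ≤ 0` (Mathlib's `padicValRat`,
  `j = 1728 ↦ 0`); on additive potentially-good rows (`v₃(j) ≥ 0`; `Iₙ*`/`III`/`III*` already have the
  tower by p251574 / T-b9) this is exactly Elkies' value `v₃(j − 1728) = 3` (to be combined with
  p256589's Kodaira bound `II/IV/IV*/II*` on the class side by ARM B).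

References: [SerreAbelianLadic1968] IV-23 Lemma 3; N. Elkies, arXiv:math/0612734.
-/

noncomputable section

open scoped Classical

open WeierstrassCurve

namespace Summit.BirchSwinnertonDyer.Rank1Residual.GaloisImage

variable (W : WeierstrassCurve ℚ) [W.IsElliptic]

/-- `v₃(1728) = 3` (`1728 = 2⁶·3³`). [folklore] -/
theorem padicValRat_three_1728 : padicValRat 3 (1728 : ℚ) = 3 := by
  haveI : Fact (Nat.Prime 3) := ⟨Nat.prime_three⟩
  have h27 : padicValNat 3 (3 ^ 3 * 64) = 3 := by
    rw [padicValNat.mul (by norm_num) (by norm_num), padicValNat.prime_pow,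
      padicValNat.eq_zero_of_not_dvd (by norm_num)]
  rw [show (1728 : ℚ) = ((3 ^ 3 * 64 : ℕ) : ℚ) by norm_num, padicValRat.of_nat, h27]; rfl

/-- **The wild tower in `j`-form**: `ρ̄_{E,3}` onto and `v₃(j(E)) ∈ {1, 2}` ⟹ `ρ̄_{E,3ⁿ}` onto for
every `n` (for `v₃(j) < 3 = v₃(1728)` one has `v₃(j − 1728) = v₃(j)`).
[cite: SerreAbelianLadic1968, Ch. IV §3.4, Lemma 3 (IV-23)] -/
theorem towerSurj_three_of_surj_of_padicValRat_j {m : ℕ} (hm : m = 1 ∨ m = 2)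
    (hj : padicValRat 3 W.j = m) (hsurj : W.HasSurjectiveModNGaloisRep 3) (n : ℕ) :
    W.HasSurjectiveModNGaloisRep (3 ^ n : ℕ) := by
  haveI : Fact (Nat.Prime 3) := ⟨Nat.prime_three⟩
  have hj0 : W.j ≠ 0 := by
    intro h0; rw [h0, padicValRat.zero] at hj; exact_mod_cast (show (m : ℤ) ≠ 0 by omega) hj.symm
  have hlt : padicValRat 3 W.j < padicValRat 3 (1728 : ℚ) := by rw [hj, padicValRat_three_1728]; omega
  have hne : W.j + -1728 ≠ 0 := by
    intro h0
    have : W.j = 1728 := by linear_combination h0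
    rw [this] at hlt; exact lt_irrefl _ hlt
  have hsub : padicValRat 3 (W.j - 1728) = m := by
    rw [sub_eq_add_neg, padicValRat.add_eq_of_lt (p := 3) hne hj0 (by norm_num)
      (by rwa [padicValRat.neg]), hj]
  exact towerSurj_three_of_surj_of_padicValRat_j_sub W (by omega) hsub hsurj n

/-- **A failing tower at `3` forces `v₃(j − 1728) ∉ {1, 2, 4}`** (any model, any reduction type):
contrapositive of `towerSurj_three_of_surj_of_padicValRat_j_sub`.
[cite: SerreAbelianLadic1968, Ch. IV §3.4, Lemma 3 (IV-23)] -/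
theorem not_padicValRat_j_sub_of_not_towerSurj_three (hsurj : W.HasSurjectiveModNGaloisRep 3)
    (hnot : ¬ ∀ n : ℕ, W.HasSurjectiveModNGaloisRep (3 ^ n : ℕ)) :
    ¬ (padicValRat 3 (W.j - 1728) = 1 ∨ padicValRat 3 (W.j - 1728) = 2 ∨
      padicValRat 3 (W.j - 1728) = 4) := by
  rintro (h | h | h)
  · exact hnot (towerSurj_three_of_surj_of_padicValRat_j_sub W (m := 1) (by omega)
      (by exact_mod_cast h) hsurj)
  · exact hnot (towerSurj_three_of_surj_of_padicValRat_j_sub W (m := 2) (by omega)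
      (by exact_mod_cast h) hsurj)
  · exact hnot (towerSurj_three_of_surj_of_padicValRat_j_sub W (m := 4) (by omega)
      (by exact_mod_cast h) hsurj)


/-! ### The two regimes together: `1 ≤ v₃(j − 1728) ≠ 3` -/

/-- **THE `3`-ADIC TOWER OFF `v₃(j − 1728) = 3`.**  `E/ℚ` elliptic (any model) with
`v₃(j(E) − 1728) = m`, `1 ≤ m`, `m ≠ 3`, and `ρ̄_{E,3}` onto ⟹ `ρ̄_{E,3ⁿ}` onto for every `n`
(`m ∈ {1, 2, 4}`: `WildThreeAdicTower`; `m ≥ 5`: §3).  Hence an EXOTIC curve — `ρ̄_{E,3}` onto, `ρ_{E,9}`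
not — with `v₃(j − 1728) ≥ 1` has `v₃(j − 1728) = 3`, the value on Elkies' `9`-deficient family.
[cite: SerreAbelianLadic1968, Ch. IV §3.4, Lemma 3 (IV-23)] -/
theorem towerSurj_three_of_surj_of_padicValRat_j_sub_ne_three {m : ℕ} (hm1 : 1 ≤ m) (hm3 : m ≠ 3)
    (hj : padicValRat 3 (W.j - 1728) = m) (hsurj : W.HasSurjectiveModNGaloisRep 3) (n : ℕ) :
    W.HasSurjectiveModNGaloisRep (3 ^ n : ℕ) := by
  by_cases hm5 : 5 ≤ m
  · exact towerSurj_three_of_surj_of_five_le_padicValRat_j_sub W hm5 hj hsurj n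
  · exact towerSurj_three_of_surj_of_padicValRat_j_sub W (by omega) hj hsurj n

/-- **The kernel bound on EXOTIC**: `ρ̄_{E,3}` onto and the `3`-adic tower FAILING force
`v₃(j − 1728) = 3` or `v₃(j − 1728) ≤ 0` (as read by `padicValRat`, with `j = 1728 ↦ 0`).
[cite: SerreAbelianLadic1968, Ch. IV §3.4, Lemma 3 (IV-23)] -/
theorem padicValRat_j_sub_eq_three_or_nonpos_of_not_towerSurj_three
    (hsurj : W.HasSurjectiveModNGaloisRep 3) (hnot : ¬ ∀ n : ℕ, W.HasSurjectiveModNGaloisRep (3 ^ n : ℕ)) :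
    padicValRat 3 (W.j - 1728) = 3 ∨ padicValRat 3 (W.j - 1728) ≤ 0 := by
  by_contra h
  rw [not_or, not_le] at h
  obtain ⟨hne, hpos⟩ := h
  obtain ⟨m, hm⟩ : ∃ m : ℕ, padicValRat 3 (W.j - 1728) = m := ⟨_, (Int.toNat_of_nonneg hpos.le).symm⟩
  have hm1 : 1 ≤ m := by omega
  have hm3 : m ≠ 3 := by rintro rfl; exact hne (by exact_mod_cast hm)
  exact hnot (towerSurj_three_of_surj_of_padicValRat_j_sub_ne_three W hm1 hm3 hm hsurj)


end Summit.BirchSwinnertonDyer.Rank1Residual.GaloisImage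

end
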